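import Mathlib
import HarnessLib
import Summits.MatrixMultiplication.MatrixMultiplication.Theorems.OutsiderSandwichToricComplement
import Summits.MatrixMultiplication.MatrixMultiplication.Theorems.OutsiderSandwichToricUniqueness
import Summits.MatrixMultiplication.MatrixMultiplication.Theorems.OutsiderSandwichToricCeilingPow
import Summits.MatrixMultiplication.MatrixMultiplication.Theorems.OutsiderSandwichToricCeilingPowMixedCrossed
import Summits.MatrixMultiplication.MatrixMultiplication.Theorems.OutsiderSandwichToricCeilingPowMixedSpread

/-!
# OutsiderSandwich — no toric `⟨3^N - 2⟩` in a ONE-CW product frame of `cw₂^{⊠N}`, every `N ≥ 3`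
(modulo the `N = 2` census): two perfect matchings of every admissible complement
(decomp-mm lens 4, gen 46, kernel K46-8; THESES-FREE, `ω`-free; helper toward `LaserTangency`,
stmt-32268 — the extremal subrank/packing cells of the literal host `kroneckerPow (cwTensor ℂ 2) N`)

LABEL.  TORIC · UNIFORM IN `N` (a theorem for every `N ≥ 3`) · NEC-side instrument of the
decomposition cell; CONDITIONAL on the finite `N = 2` census (hypothesis `hB`: every lawful
co-size-2 complement of the two mixed frames `cw ⊠ D`, `D ⊠ cw` has a perfect matching:
`2 × 10800` lawful ordered letter configurations, `2 × 1152` complements as sets; checked by the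
cell's census NODE-g46 §2, to be kernel-certified in part 7).  The rates / the crux
`h₁ = LaserTangency` and the route's `closes` are untouched.

WHAT.  `productFrame_oneCw_no_diagonal_comb_degeneration_sub_two`: for `N ≥ 3` and a product
basis `κ` with EXACTLY ONE Coppersmith–Winograd coordinate, no diagonal-free `Ψ ⊆ frame κ` with
`#Ψ ≥ 3^N - 2` is a combinatorial degeneration — so the toric ceiling of these frames is
`≤ 3^N - 3` for all `N ≥ 3` (at `N = 2` the mixed value is `7 = 3² - 2`, `…MixedSeven`, so `N ≥ 3`
is necessary).  MAIN LEMMA `hasPMκ_twoPMκ`: for every `m ≥ 2` and every one-cw `κ : Fin m → Bool`,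
every lawful co-size-2 complement (`lawκ` at every coordinate: `twice` at permutation coordinates,
the parity law `cwLaw` at the cw coordinate — `…ToricComplement.two_missing_letters_dcoord /
cwcoord`) has a perfect matching in `frame κ`, and for `m ≥ 3` two distinct ones.  Induction on
`m` from the census base; the step `twoPMκ_step` always pivots at a PERMUTATION coordinate `p`
(the cw coordinate stays in the tail, so the class is stable): a doubled pair at some permutation
coordinate ⇒ PURE (`…MixedPure.twoPMκ_pure`, second matching from the cw tail coordinate) or
CROSSED (`…MixedCrossed.twoPMκ_crossedX`, mirror), up to rotating the roles of `x, y, z`;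
else SPREAD (`…MixedSpread.twoPMκ_spread`, second matching from a permutation tail coordinate).
A permutation tail coordinate `j₀` (flags) exists because `m + 1 ≥ 3` leaves `≥ 2` permutation
coordinates.  Conclusion as in `…PowSubTwo` §8 (`…ToricUniqueness.no_comb_degeneration_of_two_
matchings`, `…ToricCeilingPow.productFrame_no_diagonal_comb_degeneration` for `#Ψ ≥ 3^N - 1`).
-/

set_option linter.dupNamespace false

namespace Summit.MatrixMultiplication.MatrixMultiplication.Theorems.OutsiderSandwichToricCeilingPowMixed

open Finset
open Summit.MatrixMultiplication.MatrixMultiplication.Theorems.OutsiderSandwichToricCeilingPowFibres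
  (Word Tr3 slotB frame)
open Summit.MatrixMultiplication.MatrixMultiplication.Theorems.OutsiderSandwichToricCeilingPowSubTwoGlue
open Summit.MatrixMultiplication.MatrixMultiplication.Theorems.OutsiderSandwichToricCeilingPowSubTwoRules
open Summit.MatrixMultiplication.MatrixMultiplication.Theorems.OutsiderSandwichToricCeilingPowMixedGlue
open Summit.MatrixMultiplication.MatrixMultiplication.Theorems.OutsiderSandwichToricCeilingPowMixedRules
open Summit.MatrixMultiplication.MatrixMultiplication.Theorems.OutsiderSandwichToricCeilingPowMixedPure
  (twoPMκ_pure)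
open Summit.MatrixMultiplication.MatrixMultiplication.Theorems.OutsiderSandwichToricCeilingPowMixedCrossed
  (twoPMκ_crossedX)
open Summit.MatrixMultiplication.MatrixMultiplication.Theorems.OutsiderSandwichToricCeilingPowMixedSpread
  (twoPMκ_spread)
open Summit.MatrixMultiplication.MatrixMultiplication.Theorems.OutsiderSandwichToricCeilingPow
  (productFrame_no_diagonal_comb_degeneration)
open Summit.MatrixMultiplication.MatrixMultiplication.Theorems.OutsiderSandwichToricUniqueness
  (no_comb_degeneration_of_two_matchings)
open Summit.MatrixMultiplication.MatrixMultiplication.Theorems.OutsiderSandwichToricComplement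
  (image_eq_sdiff_pair two_missing_letters_dcoord two_missing_letters_cwcoord)

variable {m n : ℕ}

/-! ## §1 The induction class and coordinates -/

/-- Of two distinct coordinates of an at-most-one-cw basis, one is a permutation coordinate. -/
theorem false_of_two {κ : Fin n → Bool} (hκ : ∀ i j, κ i = true → κ j = true → i = j) {i j : Fin n}
    (hij : i ≠ j) : κ i = false ∨ κ j = false := by
  by_contra h
  simp only [not_or, Bool.not_eq_false] at h
  exact hij (hκ i j h.1 h.2)

/-- A permutation TAIL coordinate exists (`m ≥ 2` tail coordinates, at most one of them cw). -/
theorem exists_tail_false {p : Fin (m + 1)} {κ : Fin (m + 1) → Bool}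
    (hκ : ∀ i j, κ i = true → κ j = true → i = j) (hm : 2 ≤ m) :
    ∃ j₀ : Fin m, κ (p.succAbove j₀) = false := by
  have hne : (⟨0, by omega⟩ : Fin m) ≠ ⟨1, by omega⟩ := by simp [Fin.ext_iff]
  rcases false_of_two hκ (Fin.succAbove_right_injective.ne hne) with h | h
  exacts [⟨_, h⟩, ⟨_, h⟩]

/-- A permutation coordinate exists. -/
theorem exists_coord_false {κ : Fin (m + 1) → Bool} (hκ : ∀ i j, κ i = true → κ j = true → i = j)
    (hm : 2 ≤ m) : ∃ p, κ p = false := by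
  have hne : (⟨0, by omega⟩ : Fin (m + 1)) ≠ ⟨1, by omega⟩ := by simp [Fin.ext_iff]
  rcases false_of_two hκ hne with h | h
  exacts [⟨_, h⟩, ⟨_, h⟩]

/-- The cw coordinate is a TAIL coordinate of any permutation pivot. -/
theorem exists_tail_true {p : Fin (m + 1)} {κ : Fin (m + 1) → Bool} (hp : κ p = false)
    (hc : ∃ c, κ c = true) : ∃ j₁ : Fin m, κ (p.succAbove j₁) = true := by
  obtain ⟨c, hc⟩ := hc
  have hcp : c ≠ p := fun e => by rw [e, hp] at hc; exact Bool.false_ne_true hc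
  obtain ⟨j, hj⟩ := Fin.exists_succAbove_eq hcp
  exact ⟨j, by rw [hj]; exact hc⟩

/-- TWO DISTINCT perfect matchings transport under the rotation of the legs. -/
theorem twoPMκ_rot {κ : Fin m → Bool} {X Y Z : Finset (Word m)}
    (h : ∃ P₁ P₂, P₁ ≠ P₂ ∧ isPMκ κ P₁ X Y Z = true ∧ isPMκ κ P₂ X Y Z = true) :
    ∃ P₁ P₂, P₁ ≠ P₂ ∧ isPMκ κ P₁ Y Z X = true ∧ isPMκ κ P₂ Y Z X = true := by
  obtain ⟨P₁, P₂, hne, h₁, h₂⟩ := h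
  exact ⟨P₁.image rot, P₂.image rot, fun e => hne (image_injective rot_injective e), isPMκ_rot h₁,
    isPMκ_rot h₂⟩

/-! ## §2 The induction step and the main lemma -/

/-- THE INDUCTION STEP: two distinct perfect matchings of every lawful co-size-2 complement of a
one-cw product frame over `Word (m+1)`, `m ≥ 2`, given existence at level `m`.  Pivot rule: a
PERMUTATION coordinate with a doubled pair if there is one (PURE / CROSSED, up to rotating the
roles of `x, y, z`), else SPREAD at any permutation coordinate. -/
theorem twoPMκ_step
    (IH : ∀ κ : Fin m → Bool, (∀ i j, κ i = true → κ j = true → i = j) → (∃ i, κ i = true) →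
      ∀ x₁ x₂ y₁ y₂ z₁ z₂ : Word m, x₁ ≠ x₂ → y₁ ≠ y₂ → z₁ ≠ z₂ →
      (∀ i, lawκ (κ i) (x₁ i) (x₂ i) (y₁ i) (y₂ i) (z₁ i) (z₂ i) = true) →
      ∃ P, isPMκ κ P {x₁, x₂} {y₁, y₂} {z₁, z₂} = true)
    (hm : 2 ≤ m) {κ : Fin (m + 1) → Bool} (hκ : ∀ i j, κ i = true → κ j = true → i = j)
    (hcw : ∃ i, κ i = true) {x₁ x₂ y₁ y₂ z₁ z₂ : Word (m + 1)} (hx : x₁ ≠ x₂) (hy : y₁ ≠ y₂)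
    (hz : z₁ ≠ z₂)
    (hadm : ∀ i, lawκ (κ i) (x₁ i) (x₂ i) (y₁ i) (y₂ i) (z₁ i) (z₂ i) = true) :
    ∃ P₁ P₂, P₁ ≠ P₂ ∧ isPMκ κ P₁ {x₁, x₂} {y₁, y₂} {z₁, z₂} = true ∧
      isPMκ κ P₂ {x₁, x₂} {y₁, y₂} {z₁, z₂} = true := by
  have ih : ∀ {p : Fin (m + 1)}, κ p = false → ∀ x₁ x₂ y₁ y₂ z₁ z₂ : Word m, x₁ ≠ x₂ → y₁ ≠ y₂ →
      z₁ ≠ z₂ → (∀ j, lawκ (tailκ p κ j) (x₁ j) (x₂ j) (y₁ j) (y₂ j) (z₁ j) (z₂ j) = true) →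
      ∃ P, isPMκ (tailκ p κ) P {x₁, x₂} {y₁, y₂} {z₁, z₂} = true :=
    fun hp => IH _ (tailκ_atMostOne hκ) (exists_tail_true hp hcw)
  by_cases hD : ∃ p, κ p = false ∧ (x₁ p = x₂ p ∨ y₁ p = y₂ p ∨ z₁ p = z₂ p)
  · obtain ⟨p, hp, hdbl⟩ := hD
    obtain ⟨j₀, hj₀⟩ := exists_tail_false (p := p) hκ hm
    obtain ⟨j₁, hj₁⟩ := exists_tail_true hp hcw
    have hκ₁ := tailκ_atMostOne (p := p) hκ
    by_cases hxp : x₁ p = x₂ p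
    · by_cases hyp : y₁ p = y₂ p
      · exact twoPMκ_pure hp (ih hp) j₀ hj₀ j₁ hj₁ hx hy hz hadm hxp hyp
      · exact twoPMκ_crossedX hp hκ₁ (ih hp) j₀ hj₀ hx hadm hxp hyp
    by_cases hyp : y₁ p = y₂ p
    · have hadm' : ∀ i, lawκ (κ i) (y₁ i) (y₂ i) (z₁ i) (z₂ i) (x₁ i) (x₂ i) = true :=
        fun i => lawκ_rot _ _ _ _ _ _ _ (hadm i)
      have two : ∃ P₁ P₂, P₁ ≠ P₂ ∧ isPMκ κ P₁ {y₁, y₂} {z₁, z₂} {x₁, x₂} = true ∧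
          isPMκ κ P₂ {y₁, y₂} {z₁, z₂} {x₁, x₂} = true := by
        by_cases hzp : z₁ p = z₂ p
        · exact twoPMκ_pure hp (ih hp) j₀ hj₀ j₁ hj₁ hy hz hx hadm' hyp hzp
        · exact twoPMκ_crossedX hp hκ₁ (ih hp) j₀ hj₀ hy hadm' hyp hzp
      exact twoPMκ_rot (twoPMκ_rot two)
    have hzp : z₁ p = z₂ p := by
      rcases hdbl with h | h | h
      exacts [absurd h hxp, absurd h hyp, h]
    have hadm' : ∀ i, lawκ (κ i) (z₁ i) (z₂ i) (x₁ i) (x₂ i) (y₁ i) (y₂ i) = true :=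
      fun i => lawκ_rot _ _ _ _ _ _ _ (lawκ_rot _ _ _ _ _ _ _ (hadm i))
    exact twoPMκ_rot (twoPMκ_crossedX hp hκ₁ (ih hp) j₀ hj₀ hz hadm' hzp hxp)
  · push Not at hD
    obtain ⟨p, hp⟩ := exists_coord_false hκ hm
    obtain ⟨j₀, hj₀⟩ := exists_tail_false (p := p) hκ hm
    exact twoPMκ_spread hp (tailκ_atMostOne hκ) (ih hp) j₀ hj₀ hadm hD

/-- MAIN LEMMA (all `m ≥ 2`, resp. `m ≥ 3`; `hB` = the `N = 2` census: every lawful co-size-2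
complement of the mixed frames `cw ⊠ D`, `D ⊠ cw` has a perfect matching — `2 × 10800` lawful
ordered letter configurations, finite, NODE-g46 §2): every lawful co-size-2 complement of a
one-cw product frame over `Word m` has a perfect matching, and for `m ≥ 3` two distinct ones. -/
theorem hasPMκ_twoPMκ
    (hB : ∀ κ : Fin 2 → Bool, (∀ i j, κ i = true → κ j = true → i = j) → (∃ i, κ i = true) →
      ∀ x₁ x₂ y₁ y₂ z₁ z₂ : Word 2, x₁ ≠ x₂ → y₁ ≠ y₂ → z₁ ≠ z₂ →
      (∀ i, lawκ (κ i) (x₁ i) (x₂ i) (y₁ i) (y₂ i) (z₁ i) (z₂ i) = true) →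
      ∃ P, isPMκ κ P {x₁, x₂} {y₁, y₂} {z₁, z₂} = true) :
    ∀ m, 2 ≤ m →
    (∀ κ : Fin m → Bool, (∀ i j, κ i = true → κ j = true → i = j) → (∃ i, κ i = true) →
      ∀ x₁ x₂ y₁ y₂ z₁ z₂ : Word m, x₁ ≠ x₂ → y₁ ≠ y₂ → z₁ ≠ z₂ →
      (∀ i, lawκ (κ i) (x₁ i) (x₂ i) (y₁ i) (y₂ i) (z₁ i) (z₂ i) = true) →
      ∃ P, isPMκ κ P {x₁, x₂} {y₁, y₂} {z₁, z₂} = true) ∧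
    (3 ≤ m → ∀ κ : Fin m → Bool, (∀ i j, κ i = true → κ j = true → i = j) → (∃ i, κ i = true) →
      ∀ x₁ x₂ y₁ y₂ z₁ z₂ : Word m, x₁ ≠ x₂ → y₁ ≠ y₂ → z₁ ≠ z₂ →
      (∀ i, lawκ (κ i) (x₁ i) (x₂ i) (y₁ i) (y₂ i) (z₁ i) (z₂ i) = true) →
      ∃ P₁ P₂, P₁ ≠ P₂ ∧ isPMκ κ P₁ {x₁, x₂} {y₁, y₂} {z₁, z₂} = true ∧
        isPMκ κ P₂ {x₁, x₂} {y₁, y₂} {z₁, z₂} = true) := by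
  intro m hm
  induction m, hm using Nat.le_induction with
  | base => exact ⟨hB, fun h => absurd h (by norm_num)⟩
  | succ m hm IH =>
    refine ⟨fun κ hκ hcw x₁ x₂ y₁ y₂ z₁ z₂ hx hy hz hadm => ?_,
      fun _ κ hκ hcw x₁ x₂ y₁ y₂ z₁ z₂ hx hy hz hadm => twoPMκ_step IH.1 hm hκ hcw hx hy hz hadm⟩
    obtain ⟨P₁, -, -, h₁, -⟩ := twoPMκ_step IH.1 hm hκ hcw hx hy hz hadm
    exact ⟨P₁, h₁⟩

/-! ## §3 The theorem -/

/-- **Toric ceiling `⟨3^N - 2⟩` in ONE-CW product frames, all `N ≥ 3` (modulo the `N = 2` census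
`hB`).**  In the product frame `frame κ ⊂ (Fin N → Fin 3)³` of `cw₂^{⊠N}` in a product
basis with exactly one Coppersmith–Winograd coordinate, no diagonal-free `Ψ` with `#Ψ ≥ 3^N - 2`
is a combinatorial degeneration: `#Ψ ≥ 3^N - 1` is `…ToricCeilingPow`; for `#Ψ = 3^N - 2` the six
missing words are lawful at every coordinate (`…ToricComplement`), the complement carries two
distinct perfect matchings (`hasPMκ_twoPMκ`), and two perfect matchings on the same vertex sets
exclude a degeneration (`…ToricUniqueness`).
[TORIC · uniform in N ≥ 3 · NEC-side instrument; conditional on the finite N = 2 census;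
the rates of `h₁ = LaserTangency` untouched] -/
theorem productFrame_oneCw_no_diagonal_comb_degeneration_sub_two {R : Type*} [CommRing R]
    [LinearOrder R] [IsStrictOrderedRing R]
    (hB : ∀ κ : Fin 2 → Bool, (∀ i j, κ i = true → κ j = true → i = j) → (∃ i, κ i = true) →
      ∀ x₁ x₂ y₁ y₂ z₁ z₂ : Word 2, x₁ ≠ x₂ → y₁ ≠ y₂ → z₁ ≠ z₂ →
      (∀ i, lawκ (κ i) (x₁ i) (x₂ i) (y₁ i) (y₂ i) (z₁ i) (z₂ i) = true) →
      ∃ P, isPMκ κ P {x₁, x₂} {y₁, y₂} {z₁, z₂} = true)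
    {N : ℕ} (hN : 3 ≤ N)
    (κ : Fin N → Bool) (hκ : ∀ i j, κ i = true → κ j = true → i = j) (hcw : ∃ i, κ i = true)
    {Ψ : Finset (Tr3 N)} {a b c : Word N → R} (hsub : Ψ ⊆ frame κ)
    (hzero : ∀ t ∈ Ψ, a t.1 + b t.2.1 + c t.2.2 = 0)
    (hone : ∀ t ∈ frame κ, t ∉ Ψ → 1 ≤ a t.1 + b t.2.1 + c t.2.2)
    (hdiag : ∀ t ∈ Ψ, ∀ t' ∈ Ψ, (t.1 = t'.1 ∨ t.2.1 = t'.2.1 ∨ t.2.2 = t'.2.2) → t = t')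
    (hbig : 3 ^ N ≤ #Ψ + 2) : False := by
  by_cases h1 : 3 ^ N ≤ #Ψ + 1
  · exact productFrame_no_diagonal_comb_degeneration (by omega) κ hsub hzero hone hdiag h1
  have hcard : #Ψ + 2 = 3 ^ N := by omega
  have jΨ₁ : Set.InjOn (fun t : Tr3 N => t.1) Ψ := fun t ht t' ht' e => hdiag t ht t' ht' (Or.inl e)
  have jΨ₂ : Set.InjOn (fun t : Tr3 N => t.2.1) Ψ :=
    fun t ht t' ht' e => hdiag t ht t' ht' (Or.inr (Or.inl e))
  have jΨ₃ : Set.InjOn (fun t : Tr3 N => t.2.2) Ψ :=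
    fun t ht t' ht' e => hdiag t ht t' ht' (Or.inr (Or.inr e))
  obtain ⟨x₁, x₂, hx, hX⟩ := image_eq_sdiff_pair jΨ₁ hcard
  obtain ⟨y₁, y₂, hy, hY⟩ := image_eq_sdiff_pair jΨ₂ hcard
  obtain ⟨z₁, z₂, hz, hZ⟩ := image_eq_sdiff_pair jΨ₃ hcard
  have hlaw : ∀ i, lawκ (κ i) (x₁ i) (x₂ i) (y₁ i) (y₂ i) (z₁ i) (z₂ i) = true := fun i =>
    lawκ_of_counts _ _ _ _ _ _ _
      (fun hi α => two_missing_letters_dcoord κ hsub jΨ₁ jΨ₂ jΨ₃ hx hy hz hX hY hZ i hi α)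
      (fun hi => two_missing_letters_cwcoord κ hsub jΨ₁ jΨ₂ jΨ₃ hx hy hz hX hY hZ i hi)
  obtain ⟨P₁, P₂, hne, h₁, h₂⟩ :=
    (hasPMκ_twoPMκ hB N (by omega)).2 hN κ hκ hcw x₁ x₂ y₁ y₂ z₁ z₂ hx hy hz hlaw
  obtain ⟨f₁, j₁₁, j₁₂, j₁₃, i₁₁, i₁₂, i₁₃⟩ := isPMκ_iff.1 h₁
  obtain ⟨f₂, j₂₁, j₂₂, j₂₃, i₂₁, i₂₂, i₂₃⟩ := isPMκ_iff.1 h₂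
  exact no_comb_degeneration_of_two_matchings hne f₁ f₂ j₁₁ j₁₂ j₁₃ j₂₁ j₂₂ j₂₃
    (i₁₁.trans i₂₁.symm) (i₁₂.trans i₂₂.symm) (i₁₃.trans i₂₃.symm)
    ⟨Ψ, a, b, c, hzero, hone, jΨ₁, jΨ₂, jΨ₃, hX.trans i₁₁.symm, hY.trans i₁₂.symm,
      hZ.trans i₁₃.symm⟩

end Summit.MatrixMultiplication.MatrixMultiplication.Theorems.OutsiderSandwichToricCeilingPowMixed
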